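import Summits.CriticalPhenomena.Ising3DConformalLimit.Theses.FKParityRobustness
import Summits.CriticalPhenomena.Ising3DConformalLimit.Theorems.FKParityRobustnessDepletionBoundHTE
import Summits.CriticalPhenomena.Ising3DConformalLimit.Theorems.FKParityRobustnessShadowGivesJoin
import Summits.CriticalPhenomena.Ising3DConformalLimit.Theorems.FKParityRobustnessIndependentStrandsJoinStubPairSplitAux
import Literature.Probability.LatticeModels.ModifiedSimonInequality
import HarnessLib

/-!
# Crux IndependentStrandsJoin (stmt-CriticalPhenomena-14625), line Sketch — stub depletionBound

Route `FKParityRobustness`, sub-problem `Ising3DConformalLimit`.  This file proves the registered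
stub `stub_depletionBound : DepletionBound` = the route's LEVER (item stmt-CriticalPhenomena-14628,
verbatim): on every finite graph `G`, for `β ≥ 0`, `t = tanh β` and `x, y ∉ S`,

  `(Σ_{F ∈ 𝒯(xy), K_x(F) avoids S} t^{|F|}) · ⟨σ_xσ_y⟩^free_G ≤ Z^{xy}_t(G) · ⟨σ_xσ_y⟩^free_{G∖S}`,

where `𝒯(xy) = tJoins G univ {x, y}`, `K_x(F) = {d ∈ F | ∃ w ∈ d, x ↝_F w}` is the `x`-cluster
of `F` (the edges of the `F`-component of `x`) and `⟨·⟩_{G∖S} = isingCorr G (univ ∖ S) β 0 free`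
(couplings at `S` switched off).

Proof.  Write `g_Λ(A) = hteSum G Λ t A`, so that `Z^A = g_univ(A)`, `⟨σ_xσ_y⟩_G = Z^{xy}/Z^∅`
and `⟨σ_xσ_y⟩_{G∖S} = g_Λ(xy)/g_Λ(∅)` with `Λ = univ ∖ S` (high-temperature expansion); it
suffices to show `Avoid · g_Λ(∅) ≤ Z^∅ · g_Λ(xy)` (`core`).  FIBRE DECOMPOSITION (`fibre_sum`,
the volume version of the fibre bijection of `…StubPairSplitAux`): `F ↦ (K_x(F), F ∖ K_x(F))` is
a bijection from the `T`-joins of `xy` inside a volume `Λ'` with prescribed cluster `K` onto the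
even subgraphs of `Λ' ∩ dV(K)`, `dV(K) = {w | x ↝̸_K w}`, for every admissible `K`
(self-clustered, odd set `{x, y}`, avoiding `S`: the CLUSTER INDEX SET `𝒦`, passed to the lemmas
as a variable with defining hypothesis `h𝒦`).  Hence, over the SAME index set,
`Avoid = Σ_{K ∈ 𝒦} t^{|K|} g_{dV(K)}(∅)` (`avoid_sum_eq`, `Λ' = univ`) and
`g_Λ(xy) = Σ_{K ∈ 𝒦} t^{|K|} g_{Λ ∩ dV(K)}(∅)` (`hteSum_sdiff_pair_eq`, `Λ' = Λ`).  TERMWISE,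
`g_{dV(K)}(∅) g_Λ(∅) ≤ g_{dV(K) ∩ Λ}(∅) g_{dV(K) ∪ Λ}(∅) ≤ g_{dV(K) ∩ Λ}(∅) Z^∅` by the
vertex-set supermodularity of `Λ ↦ log g_Λ(∅)` (Aizenman 1982, Lemma 9.3 / Aizenman–Fernández
1986, Claim (4.15); tree: `DepletionBound.hteSum_empty_supermodular`) and the monotonicity of
`Ω ↦ g_Ω(∅)` (`hteSum_empty_mono`); multiply by `t^{|K|} ≥ 0` and sum.

Theorem-only file; the cluster calculus (`StubPairSplit.*`) is the landed port of §4a of the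
standing disprover's work file `Cruxes/StrandShadow/Disproof.lean`.  References: M. Aizenman,
Comm. Math. Phys. 86 (1982), Lemma 9.3; M. Aizenman, R. Fernández, J. Stat. Phys. 44 (1986),
Claim (4.15); H. Duminil-Copin, lectures on the Ising and Potts models (2017), §2.2.1.
-/

noncomputable section

open Finset SimpleGraph
open Literature.Probability.LatticeModels
open Summit.CriticalPhenomena.Ising3DConformalLimit.Theses.FKParityRobustness
open scoped Classical BigOperators

namespace Summit.CriticalPhenomena.Ising3DConformalLimit.Theorems

namespace StubDepletionBound

variable {V : Type*} [Fintype V] [DecidableEq V]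

omit [Fintype V] [DecidableEq V] in
/-- A vertex reachable from `x` inside `F` is `x` itself or lies on an edge of `F`. -/
theorem eq_or_exists_mem_of_rch {F : Finset (Sym2 V)} {x v : V}
    (h : (fromEdgeSet ↑F).Reachable x v) : v = x ∨ ∃ e ∈ F, v ∈ e := by
  rw [reachable_iff_reflTransGen] at h
  induction h with
  | refl => exact Or.inl rfl
  | tail _ hbc _ =>
    rw [fromEdgeSet_adj] at hbc
    exact Or.inr ⟨_, Finset.mem_coe.1 hbc.1, Sym2.mem_mk_right _ _⟩

variable (G : SimpleGraph V) [DecidableRel G.Adj]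

/-- `tJoins G univ A` is the index set of `hteSum G univ · A`. -/
theorem tJoins_univ_eq (A : Finset V) :
    tJoins G Set.univ A = (edgesIn G univ).powerset.filter (fun F => oddVerts univ F = A) := by
  ext F
  simp only [mem_filter, mem_powerset, mem_tJoins, Set.subset_univ, true_and,
    DepletionBound.oddVerts_univ_eq_iff, DepletionBound.edgesIn_univ]

/-- Edge sets inside `Λ` with `Λ`-odd set `A` are `T`-joins of `G` with terminal set `A`. -/
theorem mem_tJoins_of_mem_volume {Λ A : Finset V} {F : Finset (Sym2 V)}
    (hF : F ∈ (edgesIn G Λ).powerset.filter (fun F => oddVerts Λ F = A)) :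
    F ∈ tJoins G Set.univ A := by
  rw [mem_filter, mem_powerset] at hF
  obtain ⟨hFE, hodd⟩ := hF
  rw [mem_tJoins]
  refine ⟨fun e he => mem_edgeFinset.2 (mem_edgesIn_iff.1 (hFE he)).1, Set.subset_univ _,
    fun v => ?_⟩
  by_cases hv : v ∈ Λ
  · rw [← hodd, oddVerts, mem_filter]
    exact ⟨fun h => ⟨hv, h⟩, fun h => h.2⟩
  · have h0 : #(F.filter (v ∈ ·)) = 0 := by
      rw [card_eq_zero, filter_eq_empty_iff]
      intro e he hve
      exact hv ((mem_edgesIn_iff.1 (hFE he)).2 v hve)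
    rw [h0]
    refine ⟨fun h => absurd h Nat.not_odd_zero, fun h => ?_⟩
    rw [← hodd] at h
    exact absurd (oddVerts_subset Λ F h) hv

/-- **Monotonicity of `Ω ↦ g_Ω(∅)`** for `t ≥ 0`: an even subgraph inside `Ω₁ ⊆ Ω₂` is an even
subgraph inside `Ω₂` (a sub-sum with nonnegative terms). -/
theorem hteSum_empty_mono {t : ℝ} (ht : 0 ≤ t) {Ω₁ Ω₂ : Finset V} (h : Ω₁ ⊆ Ω₂) :
    hteSum G Ω₁ t ∅ ≤ hteSum G Ω₂ t ∅ := by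
  unfold hteSum
  refine Finset.sum_le_sum_of_subset_of_nonneg ?_ (fun F _ _ => pow_nonneg ht _)
  intro F hF
  rw [mem_filter, mem_powerset] at hF ⊢
  refine ⟨hF.1.trans (edgesIn_mono G h), ?_⟩
  rw [oddVerts, filter_eq_empty_iff]
  intro v hv hodd
  by_cases hv1 : v ∈ Ω₁
  · have hmem : v ∈ oddVerts Ω₁ F := mem_filter.2 ⟨hv1, hodd⟩
    rw [hF.2] at hmem
    exact notMem_empty v hmem
  · have h0 : #(F.filter fun e => v ∈ e) = 0 := by
      rw [card_eq_zero, filter_eq_empty_iff]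
      intro e he hve
      exact hv1 ((mem_edgesIn_iff.1 (hF.1 he)).2 v hve)
    rw [h0] at hodd
    exact Nat.not_odd_zero hodd

/-- **Fibre bijection in a volume** (volume version of `StubPairSplit.fibre_sum`).  Fix a volume
`Λ` and a self-clustered `K ⊆ ℰ_Λ` at `x` with odd set `S₀`, and let `D = dV(K)`.  Then
`F ↦ F ∖ K` is a bijection from `{F ⊆ ℰ_Λ : ∂_Λ F = S₀, K_x(F) = K}` onto the even subgraphs of
`Λ ∩ D`, with inverse `R ↦ K ∪ R`. -/
theorem fibre_sum (Λ : Finset V) {K : Finset (Sym2 V)} {x : V} {S₀ D : Finset V}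
    (hD : D = univ.filter (fun w => ¬ (fromEdgeSet ↑K).Reachable x w))
    (hKΛ : K ⊆ edgesIn G Λ) (hKself : {d ∈ K | ∃ w ∈ d, (fromEdgeSet ↑K).Reachable x w} = K)
    (hKodd : ∀ v, Odd #{d ∈ K | v ∈ d} ↔ v ∈ S₀) (g : Finset (Sym2 V) → ℝ) :
    ∑ F ∈ ((edgesIn G Λ).powerset.filter (fun F => oddVerts Λ F = S₀)).filter
        (fun F : Finset (Sym2 V) => {d ∈ F | ∃ w ∈ d, (fromEdgeSet ↑F).Reachable x w} = K), g F =
      ∑ R ∈ (edgesIn G (Λ ∩ D)).powerset.filter (fun R => oddVerts (Λ ∩ D) R = ∅), g (K ∪ R) := by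
  -- adapted from Cruxes/StrandShadow/Disproof.lean (`fibre_sum`), through its landed port
  have hDmem : ∀ {v : V}, v ∈ D ↔ ¬ (fromEdgeSet ↑K).Reachable x v := fun {v} => by
    rw [hD]; exact StubPairSplit.mem_dVol
  -- vertices of `S₀` are reachable
  have hS₀ : ∀ v ∈ S₀, (fromEdgeSet ↑K).Reachable x v := fun v hv =>
    StubPairSplit.rch_of_edeg_ne_zero hKself (fun h0 => by
      have := (hKodd v).2 hv; rw [h0] at this; exact Nat.not_odd_zero this)
  have hKavoid : ∀ {R : Finset (Sym2 V)}, R ⊆ edgesIn G (Λ ∩ D) →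
      ∀ e ∈ R, ∀ v ∈ e, ¬ (fromEdgeSet ↑K).Reachable x v := fun hRE e he v hv =>
    hDmem.1 (mem_inter.1 ((mem_edgesIn_iff.1 (hRE he)).2 v hv)).2
  refine Finset.sum_bij' (fun F _ => F \ K) (fun R _ => K ∪ R) ?_ ?_ ?_ ?_ ?_
  · -- `F ↦ F \ K` lands in the even subgraphs of the depleted volume
    intro F hF
    rw [mem_filter, mem_filter, mem_powerset] at hF
    obtain ⟨⟨hFE, hFodd⟩, hcl⟩ := hF
    have havoid : ∀ e ∈ F \ K, ∀ v ∈ e, ¬ (fromEdgeSet ↑K).Reachable x v := by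
      have := StubPairSplit.sdiff_cluster_avoid F x
      rw [hcl] at this
      exact this
    have hKF : K ⊆ F := hcl ▸ StubPairSplit.cluster_subset F x
    have hdeg : ∀ v, #{d ∈ F | v ∈ d} = #{d ∈ K | v ∈ d} + #{d ∈ F \ K | v ∈ d} :=
      fun v => by rw [← StubPairSplit.edeg_union disjoint_sdiff, union_sdiff_of_subset hKF]
    rw [mem_filter, mem_powerset]
    refine ⟨fun e he => ?_, ?_⟩
    · rw [mem_edgesIn_iff]
      have he' := mem_edgesIn_iff.1 (hFE (mem_sdiff.1 he).1)
      exact ⟨he'.1, fun v hv => mem_inter.2 ⟨he'.2 v hv, hDmem.2 (havoid e he v hv)⟩⟩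
    · rw [oddVerts, filter_eq_empty_iff]
      intro v hv hodd
      have hvK : ¬ (fromEdgeSet ↑K).Reachable x v := hDmem.1 (mem_inter.1 hv).2
      have h1 : Odd #{d ∈ F | v ∈ d} := by
        rw [hdeg v, StubPairSplit.edeg_eq_zero_of_not_rch hKself hvK, zero_add]
        exact hodd
      have hvS : v ∈ S₀ := by
        have hmem : v ∈ oddVerts Λ F := mem_filter.2 ⟨(mem_inter.1 hv).1, h1⟩
        rwa [hFodd] at hmem
      exact hvK (hS₀ v hvS)
  · -- `R ↦ K ∪ R` lands in the fibre
    intro R hR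
    rw [mem_filter, mem_powerset] at hR
    obtain ⟨hRE, hRodd⟩ := hR
    have havoid := hKavoid hRE
    have hdisj : Disjoint K R := StubPairSplit.disjoint_of_avoid hKself havoid
    rw [mem_filter, mem_filter, mem_powerset]
    refine ⟨⟨?_, ?_⟩, StubPairSplit.cluster_union_eq hKself havoid⟩
    · intro e he
      rcases mem_union.1 he with h | h
      · exact hKΛ h
      · exact edgesIn_mono G inter_subset_left (hRE h)
    · ext v
      rw [oddVerts, mem_filter, StubPairSplit.edeg_union hdisj]
      by_cases hv : (fromEdgeSet ↑K).Reachable x v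
      · have h0 : #{d ∈ R | v ∈ d} = 0 :=
          StubPairSplit.edeg_eq_zero_of_avoid fun e he hve => havoid e he v hve hv
        rw [h0, add_zero, hKodd v]
        refine ⟨fun h => h.2, fun hvS => ⟨?_, hvS⟩⟩
        -- `v ∈ S₀` has nonzero `K`-degree, so it lies on an edge of `K ⊆ ℰ_Λ`
        have hne : #{d ∈ K | v ∈ d} ≠ 0 := fun h0' => by
          have := (hKodd v).2 hvS; rw [h0'] at this; exact Nat.not_odd_zero this
        obtain ⟨e, he⟩ := Finset.card_pos.1 (Nat.pos_of_ne_zero hne)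
        rw [mem_filter] at he
        exact (mem_edgesIn_iff.1 (hKΛ he.1)).2 v he.2
      · rw [StubPairSplit.edeg_eq_zero_of_not_rch hKself hv, zero_add]
        constructor
        · rintro ⟨hvΛ, hodd⟩
          have hmem : v ∈ oddVerts (Λ ∩ D) R :=
            mem_filter.2 ⟨mem_inter.2 ⟨hvΛ, hDmem.2 hv⟩, hodd⟩
          rw [hRodd] at hmem
          exact absurd hmem (notMem_empty v)
        · intro hvS
          exact absurd (hS₀ v hvS) hv
  · -- left inverse
    intro F hF
    rw [mem_filter] at hF
    exact union_sdiff_of_subset (hF.2 ▸ StubPairSplit.cluster_subset F x)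
  · -- right inverse
    intro R hR
    rw [mem_filter, mem_powerset] at hR
    exact union_sdiff_cancel_left (StubPairSplit.disjoint_of_avoid hKself (hKavoid hR.1))
  · -- summand
    intro F hF
    rw [mem_filter] at hF
    rw [union_sdiff_of_subset (hF.2 ▸ StubPairSplit.cluster_subset F x)]

/-- **Fibre evaluation**: over the fibre of `K` in the volume `Λ`, with `D = dV(K)`,
`Σ t^{|F|} = t^{|K|} · g_{Λ ∩ D}(∅)`. -/
theorem fibre_eval (Λ : Finset V) {K : Finset (Sym2 V)} {x : V} {S₀ D : Finset V}
    (hD : D = univ.filter (fun w => ¬ (fromEdgeSet ↑K).Reachable x w))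
    (hKΛ : K ⊆ edgesIn G Λ) (hKself : {d ∈ K | ∃ w ∈ d, (fromEdgeSet ↑K).Reachable x w} = K)
    (hKodd : ∀ v, Odd #{d ∈ K | v ∈ d} ↔ v ∈ S₀) (t : ℝ) :
    ∑ F ∈ ((edgesIn G Λ).powerset.filter (fun F => oddVerts Λ F = S₀)).filter
        (fun F : Finset (Sym2 V) => {d ∈ F | ∃ w ∈ d, (fromEdgeSet ↑F).Reachable x w} = K),
        t ^ #F = t ^ #K * hteSum G (Λ ∩ D) t ∅ := by
  rw [fibre_sum G Λ hD hKΛ hKself hKodd (fun F => t ^ #F)]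
  have hsummand : ∀ R ∈ (edgesIn G (Λ ∩ D)).powerset.filter (fun R => oddVerts (Λ ∩ D) R = ∅),
      t ^ #(K ∪ R) = t ^ #K * t ^ #R := by
    intro R hR
    rw [mem_filter, mem_powerset] at hR
    have havoid : ∀ e ∈ R, ∀ v ∈ e, ¬ (fromEdgeSet ↑K).Reachable x v := fun e he v hv => by
      have hvD := (mem_inter.1 ((mem_edgesIn_iff.1 (hR.1 he)).2 v hv)).2
      rw [hD, mem_filter] at hvD
      exact hvD.2
    rw [card_union_of_disjoint (StubPairSplit.disjoint_of_avoid hKself havoid), pow_add]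
  rw [Finset.sum_congr rfl hsummand, ← Finset.mul_sum]
  rfl

/-- The `x`-cluster of a `T`-join of the pair `xy` avoiding `S` lies in the CLUSTER INDEX SET
`𝒦 = {K ⊆ E(G) : K_x(K) = K, ∂K = {x, y}, K avoids S}`. -/
theorem cluster_mem_index {x y : V} {S : Finset V} {𝒦 : Finset (Finset (Sym2 V))}
    (h𝒦 : 𝒦 = G.edgeFinset.powerset.filter (fun K : Finset (Sym2 V) =>
      {d ∈ K | ∃ w ∈ d, (fromEdgeSet ↑K).Reachable x w} = K ∧
        (∀ v, Odd #{d ∈ K | v ∈ d} ↔ v ∈ ({x, y} : Finset V)) ∧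
        ∀ v ∈ S, ¬ (fromEdgeSet ↑K).Reachable x v))
    {F : Finset (Sym2 V)} (hF : F ∈ tJoins G Set.univ {x, y})
    (havoid : ∀ v ∈ S, ¬ (fromEdgeSet ↑F).Reachable x v) :
    {d ∈ F | ∃ w ∈ d, (fromEdgeSet ↑F).Reachable x w} ∈ 𝒦 := by
  subst h𝒦
  have hxy : (fromEdgeSet ↑F).Reachable x y := reachable_of_mem_tJoins_pair G hF
  rw [mem_tJoins] at hF
  obtain ⟨hFG, -, hFodd⟩ := hF
  rw [mem_filter, mem_powerset]
  refine ⟨(StubPairSplit.cluster_subset F x).trans hFG, StubPairSplit.cluster_idem F x,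
    fun v => ?_, fun v hv => ?_⟩
  · by_cases hv : (fromEdgeSet ↑F).Reachable x v
    · rw [StubPairSplit.edeg_cluster_eq hv]
      exact hFodd v
    · rw [StubPairSplit.edeg_cluster_eq_zero hv, mem_insert, mem_singleton]
      refine ⟨fun h => absurd h Nat.not_odd_zero, ?_⟩
      rintro (rfl | rfl)
      · exact absurd (Reachable.refl _) hv
      · exact absurd hxy hv
  · rw [StubPairSplit.rch_cluster_iff]
    exact havoid v hv

/-- **Fibre decomposition of the avoiding sum** (volume `univ`):
`Avoid = Σ_{K ∈ 𝒦} t^{|K|} g_{univ ∩ dV(K)}(∅)`. -/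
theorem avoid_sum_eq (x y : V) (S : Finset V) (t : ℝ) {𝒦 : Finset (Finset (Sym2 V))}
    (h𝒦 : 𝒦 = G.edgeFinset.powerset.filter (fun K : Finset (Sym2 V) =>
      {d ∈ K | ∃ w ∈ d, (fromEdgeSet ↑K).Reachable x w} = K ∧
        (∀ v, Odd #{d ∈ K | v ∈ d} ↔ v ∈ ({x, y} : Finset V)) ∧
        ∀ v ∈ S, ¬ (fromEdgeSet ↑K).Reachable x v)) :
    ∑ F ∈ (tJoins G Set.univ {x, y}).filter
        (fun F : Finset (Sym2 V) => ∀ v ∈ S, ¬ (fromEdgeSet ↑F).Reachable x v), t ^ #F =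
      ∑ K ∈ 𝒦, t ^ #K *
        hteSum G (univ ∩ univ.filter (fun w => ¬ (fromEdgeSet ↑K).Reachable x w)) t ∅ := by
  have hmaps : ∀ F ∈ (tJoins G Set.univ {x, y}).filter
      (fun F : Finset (Sym2 V) => ∀ v ∈ S, ¬ (fromEdgeSet ↑F).Reachable x v),
      {d ∈ F | ∃ w ∈ d, (fromEdgeSet ↑F).Reachable x w} ∈ 𝒦 := by
    intro F hF
    rw [mem_filter] at hF
    exact cluster_mem_index G h𝒦 hF.1 hF.2
  rw [← Finset.sum_fiberwise_of_maps_to hmaps]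
  refine Finset.sum_congr rfl fun K hK => ?_
  rw [h𝒦, mem_filter, mem_powerset] at hK
  obtain ⟨hKG, hKself, hKodd, hKS⟩ := hK
  have hKΛ : K ⊆ edgesIn G univ := by
    rw [DepletionBound.edgesIn_univ]
    exact hKG
  rw [← fibre_eval G univ rfl hKΛ hKself hKodd t, tJoins_univ_eq G]
  apply Finset.sum_congr ?_ (fun _ _ => rfl)
  ext F
  simp only [mem_filter]
  refine ⟨fun ⟨⟨hF, _⟩, hcl⟩ => ⟨hF, hcl⟩, fun ⟨hF, hcl⟩ => ⟨⟨hF, fun v hv h => ?_⟩, hcl⟩⟩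
  exact hKS v hv (hcl ▸ (StubPairSplit.rch_cluster_iff F x v).2 h)

/-- **Fibre decomposition in the depleted volume** `Λ = univ ∖ S` (`x ∉ S`):
`g_Λ(xy) = Σ_{K ∈ 𝒦} t^{|K|} g_{Λ ∩ dV(K)}(∅)` over the SAME cluster index set (a self-clustered
`K` avoiding `S` lies inside `ℰ_Λ`; the cluster of a `T`-join inside `Λ` avoids `S`). -/
theorem hteSum_sdiff_pair_eq {x y : V} {S : Finset V} (hxS : x ∉ S) (t : ℝ)
    {𝒦 : Finset (Finset (Sym2 V))}
    (h𝒦 : 𝒦 = G.edgeFinset.powerset.filter (fun K : Finset (Sym2 V) =>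
      {d ∈ K | ∃ w ∈ d, (fromEdgeSet ↑K).Reachable x w} = K ∧
        (∀ v, Odd #{d ∈ K | v ∈ d} ↔ v ∈ ({x, y} : Finset V)) ∧
        ∀ v ∈ S, ¬ (fromEdgeSet ↑K).Reachable x v)) :
    hteSum G (univ \ S) t {x, y} =
      ∑ K ∈ 𝒦, t ^ #K *
        hteSum G ((univ \ S) ∩ univ.filter (fun w => ¬ (fromEdgeSet ↑K).Reachable x w)) t ∅ := by
  have hΛT : hteSum G (univ \ S) t {x, y} =
      ∑ F ∈ (edgesIn G (univ \ S)).powerset.filter (fun F => oddVerts (univ \ S) F = {x, y}),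
        t ^ #F := rfl
  have hmaps : ∀ F ∈ (edgesIn G (univ \ S)).powerset.filter
      (fun F => oddVerts (univ \ S) F = {x, y}),
      {d ∈ F | ∃ w ∈ d, (fromEdgeSet ↑F).Reachable x w} ∈ 𝒦 := by
    intro F hF
    have hFT : F ∈ tJoins G Set.univ {x, y} := mem_tJoins_of_mem_volume G hF
    rw [mem_filter, mem_powerset] at hF
    refine cluster_mem_index G h𝒦 hFT fun v hv hr => ?_
    rcases eq_or_exists_mem_of_rch hr with h | ⟨e, he, hve⟩
    · exact hxS (h ▸ hv)
    · exact (mem_sdiff.1 ((mem_edgesIn_iff.1 (hF.1 he)).2 v hve)).2 hv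
  rw [hΛT, ← Finset.sum_fiberwise_of_maps_to hmaps]
  refine Finset.sum_congr rfl fun K hK => ?_
  rw [h𝒦, mem_filter, mem_powerset] at hK
  obtain ⟨hKG, hKself, hKodd, hKS⟩ := hK
  have hKΛ : K ⊆ edgesIn G (univ \ S) := by
    intro e he
    rw [mem_edgesIn_iff]
    refine ⟨mem_edgeFinset.1 (hKG he), fun v hv => mem_sdiff.2 ⟨mem_univ v, fun hvS => ?_⟩⟩
    exact hKS v hvS (StubPairSplit.rch_of_mem_of_self hKself he hv)
  exact fibre_eval G (univ \ S) rfl hKΛ hKself hKodd t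

/-- **Core inequality** (`t = tanh β`, `β ≥ 0`, `x ∉ S`, `Λ = univ ∖ S`):
`Avoid · g_Λ(∅) ≤ g_univ(∅) · g_Λ(xy)` — termwise over the common cluster index set by the
vertex-set supermodularity `g_D(∅) g_Λ(∅) ≤ g_{D ∩ Λ}(∅) g_{D ∪ Λ}(∅)` (`D = dV(K)`) and the
monotonicity `g_{D ∪ Λ}(∅) ≤ g_univ(∅)`. -/
theorem core {β : ℝ} (hβ : 0 ≤ β) {x y : V} {S : Finset V} (hxS : x ∉ S) :
    (∑ F ∈ (tJoins G Set.univ {x, y}).filter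
        (fun F : Finset (Sym2 V) => ∀ v ∈ S, ¬ (fromEdgeSet ↑F).Reachable x v),
        Real.tanh β ^ #F) * hteSum G (univ \ S) (Real.tanh β) ∅ ≤
      hteSum G univ (Real.tanh β) ∅ * hteSum G (univ \ S) (Real.tanh β) {x, y} := by
  have ht : 0 ≤ Real.tanh β := by
    rw [Real.tanh_eq_sinh_div_cosh]
    exact div_nonneg (Real.sinh_nonneg_iff.2 hβ) (Real.cosh_pos _).le
  rw [avoid_sum_eq G x y S (Real.tanh β) rfl, hteSum_sdiff_pair_eq G hxS (Real.tanh β) rfl,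
    Finset.sum_mul, Finset.mul_sum]
  refine Finset.sum_le_sum fun K _ => ?_
  rw [univ_inter, Finset.inter_comm]
  set D : Finset V := univ.filter (fun w => ¬ (fromEdgeSet ↑K).Reachable x w)
  have hsup := DepletionBound.hteSum_empty_supermodular G hβ D (univ \ S)
  have hmono := hteSum_empty_mono G ht (subset_univ (D ∪ (univ \ S)))
  have h0 : 0 ≤ hteSum G (D ∩ (univ \ S)) (Real.tanh β) ∅ := hteSum_nonneg G _ ht _
  calc Real.tanh β ^ #K * hteSum G D (Real.tanh β) ∅ * hteSum G (univ \ S) (Real.tanh β) ∅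
      = Real.tanh β ^ #K *
          (hteSum G D (Real.tanh β) ∅ * hteSum G (univ \ S) (Real.tanh β) ∅) := by ring
    _ ≤ Real.tanh β ^ #K *
          (hteSum G (D ∩ (univ \ S)) (Real.tanh β) ∅ * hteSum G univ (Real.tanh β) ∅) :=
        mul_le_mul_of_nonneg_left (hsup.trans (mul_le_mul_of_nonneg_left hmono h0))
          (pow_nonneg ht _)
    _ = hteSum G univ (Real.tanh β) ∅ *
          (Real.tanh β ^ #K * hteSum G (D ∩ (univ \ S)) (Real.tanh β) ∅) := by ring

end StubDepletionBound

/-- **Stub 1 of line `Sketch` of crux `IndependentStrandsJoin` = route item `DepletionBound`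
(stmt-CriticalPhenomena-14628), verbatim.**  On every finite graph, for `β ≥ 0` and `x, y ∉ S`:
`(Σ_{F ∈ 𝒯(xy), K_x(F) avoids S} tanh β^{|F|}) · ⟨σ_xσ_y⟩^free_G ≤ Z^{xy} · ⟨σ_xσ_y⟩^free_{G ∖ S}`.
Proof: `⟨σ_xσ_y⟩_G = Z^{xy}/Z^∅`, `⟨σ_xσ_y⟩_{G∖S} = g_Λ(xy)/g_Λ(∅)` (high-temperature expansion,
`Λ = univ ∖ S`), `Z^A = g_univ(A)`, and `StubDepletionBound.core` (fibre decomposition over the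
source cluster + Aizenman–Fernández super-multiplicativity `hteSum_empty_supermodular`). -/
theorem stub_depletionBound : DepletionBound := by
  intro V _ _ G _ β hβ x y S hxS hyS
  have ht : 0 ≤ Real.tanh β := by
    rw [Real.tanh_eq_sinh_div_cosh]
    exact div_nonneg (Real.sinh_nonneg_iff.2 hβ) (Real.cosh_pos _).le
  have hA : ({x, y} : Finset V) ⊆ Finset.univ \ S := by
    intro v hv
    rw [Finset.mem_insert, Finset.mem_singleton] at hv
    rcases hv with rfl | rfl <;> simp [hxS, hyS]
  rw [isingCorr_univ_free_eq_loopO1_div G β,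
    isingCorr_free_eq_hteSum_div G (Finset.univ \ S) β hA,
    DepletionBound.loopO1PartitionFunction_eq_hteSum G,
    DepletionBound.loopO1PartitionFunction_eq_hteSum G]
  have key := StubDepletionBound.core G hβ (y := y) hxS
  have hZ0 : 0 < hteSum G Finset.univ (Real.tanh β) ∅ := hteSum_empty_pos G _ β
  have hg0 : 0 < hteSum G (Finset.univ \ S) (Real.tanh β) ∅ := hteSum_empty_pos G _ β
  have hZxy : 0 ≤ hteSum G Finset.univ (Real.tanh β) {x, y} := hteSum_nonneg G _ ht _
  calc _ = hteSum G Finset.univ (Real.tanh β) {x, y} *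
        ((∑ F ∈ (tJoins G Set.univ {x, y}).filter (fun F : Finset (Sym2 V) =>
          ∀ v ∈ S, ¬ (SimpleGraph.fromEdgeSet (↑F : Set (Sym2 V))).Reachable x v),
          Real.tanh β ^ F.card) / hteSum G Finset.univ (Real.tanh β) ∅) := by ring
    _ ≤ hteSum G Finset.univ (Real.tanh β) {x, y} *
        (hteSum G (Finset.univ \ S) (Real.tanh β) {x, y} /
          hteSum G (Finset.univ \ S) (Real.tanh β) ∅) :=
        mul_le_mul_of_nonneg_left
          ((div_le_div_iff₀ hZ0 hg0).2 (key.trans_eq (mul_comm _ _))) hZxy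

end Summit.CriticalPhenomena.Ising3DConformalLimit.Theorems

end
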